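import Mathlib
import Literature.NumberTheory.LFunctions.Zhang2022.TypedSection15B
import Literature.NumberTheory.LFunctions.Zhang2022.Section15BcoefSupport
import HarnessLib

/-!
# Zhang (2022) §15, (15.17): the thin range `P·t₀/T³ ≤ dl` of (15.11)'s double sum is EMPTY on the
# support of `b` — the pool item `thin_range_1517` of WP15-PLAN §3.2 (theorems only)

Topic `Literature/NumberTheory/LFunctions/Zhang2022` (Landau–Siegel audit tree; verdict-neutral).
Y. Zhang, *Discrete mean estimates and the Landau–Siegel zero*, arXiv:2211.02515v1 (2022)
[Zhang2022LandauSiegel] — **an unrefereed manuscript under adjudication; nothing here asserts or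
denies its Theorems 1–2.** Lane ZHANG-L, WP15, leaf `h15_17 : Typed.Section15B.Eq15_17 c′ bChi`
((15.17) ⇐ (15.11) + (15.15), [Z22 §15 p. 85, tex L4217–L4226]); GAP row G-L4t2-1 of the
siegel-zhang cell (the inline "Note that `P₄/d > T`").

The assembly of (15.17) at the χ-absorbed coefficients `b = bChi` (WP15-PLAN v0.2 §3.2, Sketch
`WP15Sketch.eq15_17_chi_of`) splits (15.11)'s double sum `Σ_d Σ_l b(dl)χ(l)(dl)⁻¹·𝒟₁(d,l)` at
`dl = P·t₀/T³ = P₄/T`: below it (15.15) is consumed ("`P₄/d > T`" holds there), above it — the THIN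
RANGE — a separate bound was wanted (Sketch `WP15Sketch.thin_range_1517`: the thin-range part of the
sum of `b(dl)χ(l)(dl)⁻¹·(𝒟₁(d,l) − λ₁(d)Σⱼ ℛ₁ⱼ d^{βⱼ}𝓜₁(d,l;1−βⱼ))`, times `ℛ₁*·Dp/φ(D)`, is
`≤ ε·p`). PROVED HERE, and for a trivial reason: by the tree's support theorem
`Skeleton.bcoef_eq_zero_of_P4_div_bigT_le` (`Section15BcoefSupport`: `b = u ⋆ v` with `u`
supported below `P^{1/2}`, `v` below `max(P₂, P₃)`, and `P^{1/2}·max(P₂,P₃) ≤ P₄/T` for `𝓛 ≥ 3`)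
EVERY summand of the thin range vanishes (`b(dl) = 0` for `dl ≥ P₄/T = P·t₀/T³`,
`P₄ = PT⁻²t₀`), so the thin-range sum is `0` (`thin_range_sum_eq_zero`) and the wanted bound holds
with room to spare (`thin_range_1517`, the Sketch signature without its unused hypothesis
`0 ≤ c′`). Consequence for the (15.17) assembly: the hypothesis `hthin` of
`WP15Sketch.eq15_17_chi_of` is discharged by `thin_range_1517 c'`; equivalently the thin range may be
dropped from the assembly altogether. This is the same observation as the typer's "G-L4t2-1
dissolved on the support" (`Skeleton.bigT_lt_P4_div_of_bcoef_ne_zero`), written at the level of the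
(15.11) double sum.

WHAT THIS IS NOT: a proof of (15.15) or (15.17); no claim about Theorems 1–2 of the manuscript or
about Landau–Siegel zeros. «ZHANG-L proves typed steps of arXiv:2211.02515v1 in Lean; the §18
margin is refuted as printed (G-C1); no claim about Landau–Siegel zeros or Theorem 2 follows.»

## References

* Y. Zhang, arXiv:2211.02515v1 (2022), §15 (15.11) p. 83 (tex L4154), (15.15)–(15.17) p. 85
  (tex L4217–L4226), (15.1)–(15.2) p. 79; §6 p. 12 (`P₄`). [cite: Zhang2022LandauSiegel, §15 (15.17) p. 85]
-/

noncomputable section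

open Complex Real ComplexConjugate

namespace Literature.NumberTheory.LFunctions.Zhang2022.Typed.Section15B

open Literature.NumberTheory.LFunctions.Zhang2022.Skeleton
open Literature.NumberTheory.LFunctions.Zhang2022.Typed.Section15A (bChi bchi lam1 calD1 calR1star)

/-! ## The threshold `P·t₀/T³ = P₄/T` and `𝓛 ≥ 3` eventually -/

/-- `𝓛 = log D ≥ L₀` as soon as `D ≥ ⌈e^{L₀}⌉`. [folklore] -/
private theorem le_ell_of_ceil_exp_le {L₀ : ℝ} {D : ℕ} (hD : ⌈Real.exp L₀⌉₊ ≤ D) : L₀ ≤ ell D := by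
  have h1 : Real.exp L₀ ≤ D := le_trans (Nat.le_ceil _) (by exact_mod_cast hD)
  exact (Real.le_log_iff_exp_le (lt_of_lt_of_le (Real.exp_pos _) h1)).mpr h1

/-- **`P₄/T = P·t₀/T³`** (`P₄ = PT⁻²t₀`, §6 p. 12): the thin-range threshold of the (15.17) assembly
is the support threshold of `Section15BcoefSupport`. [cite: Zhang2022LandauSiegel, §6 p. 12] -/
theorem P4_div_bigT_eq (D : ℕ) : P4 D / bigT D = bigP D * t0 D / bigT D ^ 3 := by
  have hT : bigT D ≠ 0 := (Real.exp_pos _).ne'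
  rw [P4]
  field_simp

/-- **On the thin range the coefficient vanishes**: for `𝓛 ≥ 3` and `P·t₀/T³ ≤ dl`,
`b(dl) = 0` (`b` = `Skeleton.bcoef`, by `Skeleton.bcoef_eq_zero_of_P4_div_bigT_le`), hence
`(χb)(dl) = 0` (`bChi`). [cite: Zhang2022LandauSiegel, §15 (15.2) p. 79; (15.17) p. 85] -/
theorem bChi_eq_zero_of_thin {D : ℕ} (χ : DirichletCharacter ℂ D) (hD : 3 ≤ ell D) {d l : ℕ}
    (h : bigP D * t0 D / bigT D ^ 3 ≤ ((d * l : ℕ) : ℝ)) : bChi D χ (d * l) = 0 := by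
  have hb : bcoef D (d * l) = 0 :=
    bcoef_eq_zero_of_P4_div_bigT_le hD (by rw [P4_div_bigT_eq]; exact h)
  show bchi χ (d * l) = 0
  rw [bchi, hb, mul_zero]

/-! ## The thin-range sum is zero, and the pool item `thin_range_1517` -/

section ThinRange

variable (c' : ℝ)

/-- **The thin-range part of (15.11)'s double sum VANISHES** (every `D` with `𝓛 ≥ 3`, every
character `χ` mod `D`): for `P·t₀/T³ ≤ dl` the weight `(χb)(dl)` is `0`
(`bChi_eq_zero_of_thin`), so
`Σ_{d,l ≤ P} [P·t₀/T³ ≤ dl]·(χb)(dl)χ(l)(dl)⁻¹·(𝒟₁(d,l) − λ₁(d)Σⱼ ℛ₁ⱼd^{βⱼ}𝓜₁(d,l;1−βⱼ)) = 0`.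
[cite: Zhang2022LandauSiegel, §15 (15.17) p. 85] -/
theorem thin_range_sum_eq_zero {D : ℕ} [NeZero D] (χ : DirichletCharacter ℂ D) (hD : 3 ≤ ell D) :
    ∑ d ∈ Finset.Icc 1 ⌊bigP D⌋₊, ∑ l ∈ Finset.Icc 1 ⌊bigP D⌋₊,
      (if bigP D * t0 D / bigT D ^ 3 ≤ ((d * l : ℕ) : ℝ) then
        bChi D χ (d * l) * χ (l : ZMod D) / ((d : ℂ) * l) *
          (calD1 c' χ d l -
            lam1 c' χ d 1 *
              ∑ j ∈ ({1, 2, 3} : Finset ℕ), calR1 c' χ j *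
                (d : ℂ) ^ betaJ c' D j * calM1 c' χ d l (1 - betaJ c' D j))
      else 0) = 0 := by
  refine Finset.sum_eq_zero fun d _ => Finset.sum_eq_zero fun l _ => ?_
  split_ifs with h
  · rw [bChi_eq_zero_of_thin χ hD h]
    simp
  · rfl

/-- **WP15-PLAN §3.2 pool item `thin_range_1517`** (Sketch `WP15Sketch.thin_range_1517`, its
conclusion verbatim; the Sketch's unused hypothesis `0 ≤ c′` is dropped, which only strengthens the
statement): on the thin range `P·t₀/T³ ≤ dl` of (15.11)'s double sum — where the printed "`P₄/d > T`"
of (15.15) is unavailable — the contribution of `(χb)(dl)χ(l)(dl)⁻¹·(𝒟₁(d,l) − residue model)`,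
times the prefactor `ℛ₁*·Dp/φ(D)` of (15.11)/(15.17), is `≤ ε·p` for every `ε > 0`, all large `D`
under (A), every `p ∼ P`. Reason: the sum is identically `0` (`thin_range_sum_eq_zero`; `b(dl) = 0`
there by `Skeleton.bcoef_eq_zero_of_P4_div_bigT_le`), and `0 ≤ ε·p`. The hypotheses (A), `χ` real
primitive, `p ∈ primeWindow` are not used. Discharges the hypothesis `hthin` of the (15.17) assembly
`WP15Sketch.eq15_17_chi_of` (leaf `h15_17 : Eq15_17 c′ bChi`).
[cite: Zhang2022LandauSiegel, §15 (15.17) p. 85] -/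
theorem thin_range_1517 :
    ∀ ε : ℝ, 0 < ε → ForAllLarge fun D _ χ => AssumptionA D χ → ∀ p ∈ primeWindow D,
      ‖calR1star c' χ * (D : ℂ) * p / (Nat.totient D : ℂ) *
          ∑ d ∈ Finset.Icc 1 ⌊bigP D⌋₊, ∑ l ∈ Finset.Icc 1 ⌊bigP D⌋₊,
            (if bigP D * t0 D / bigT D ^ 3 ≤ ((d * l : ℕ) : ℝ) then
              bChi D χ (d * l) * χ (l : ZMod D) / ((d : ℂ) * l) *
                (calD1 c' χ d l -
                  lam1 c' χ d 1 *
                    ∑ j ∈ ({1, 2, 3} : Finset ℕ), calR1 c' χ j *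
                      (d : ℂ) ^ betaJ c' D j * calM1 c' χ d l (1 - betaJ c' D j))
            else 0)‖ ≤ ε * p := by
  intro ε hε
  refine ⟨⌈Real.exp 3⌉₊, fun D _ χ hD _ _ _ p _ => ?_⟩
  have hℓ : 3 ≤ ell D := le_ell_of_ceil_exp_le hD
  rw [thin_range_sum_eq_zero c' χ hℓ, mul_zero, norm_zero]
  positivity

end ThinRange

end Literature.NumberTheory.LFunctions.Zhang2022.Typed.Section15B
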